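import Literature.AnabelianGeometry.AbsoluteAnabelian.AbsTopII.EllipticCuspidalizationComparison
import HarnessLib

/-!
# [AbsTopII] Cor 3.3 (i)(ii)(iii) over a class `𝒟`, RE-TYPED so that the statements constrain the
# member `X` through the DATUM (`Cor_3_3_i′ / ii′ / iii′`) — finding F-f067-1

S. Mochizuki, *Topics in Absolute Anabelian Geometry II: Decomposition Groups and Endomorphisms*
[AbsTopII] (bib `MochizukiAbsTopII2013`; locators = PDF pages of the kurims manuscript
`paper:url-585b8d0ad0d9`), §3, Corollary 3.3 pp. 67–69; Def 3.1 / Rmk 3.1.1 p. 65; §0 p. 6.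

Statements file (abc-iut cell, row «COR33-RETYPE», abc-iut-L4-lead RULING #6l; seat abc-iut-L4-t4;
typer of record of the frozen file abc-iut-L4-t6; faithfulness reader abc-iut-f-067).  The frozen
typing `EllipticModel.Cor_3_3_i/ii/iii` (`AbsTopII/EllipticCuspidalizationComparison.lean`, p409138,
UNTOUCHED) carries the §3 scheme-side data of a member `X` as FREE MODEL DATA — "`C` a `k`-core of
`X`" (`coreExt`, `toCore`), "the open subgroups `Π_D ⊆ Π_C` that arise from finite étale double
coverings `D → C` that exhibit `C` as semi-elliptic" (`doubleCovers`), the running data of (iii)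
(`Setting`, `PiD`, `cuspUX`).  FINDING F-f067-1 (abc-iut-f-067, kernel certificates p429178 /
p431138): at ONE fixed class `𝒟` the truth value of each typed row flips between two models with
the same members, because that data can be re-chosen by fiat (`doubleCovers := univ`; `coreExt :=
X` with `toCore := 𝟙`, forcing "`Π` co-Hopfian over `G`", false at `Π = Iw₂ × G_{ℚ₂}`; `Setting := ∅`).
REPAIR (this file): the scheme side is read INSIDE THE DATUM `(𝒟.datum b)` (abc-iut-L4-t13's
`RelativeAnabelianDatum`: objects, dominant `k_b`-morphisms `Hom`, "the natural map" `outerHom`),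
the new model interface `EllipticDatumModel 𝒟` carrying ONLY `Prop`-valued primitive flags with a
printed meaning on datum objects / morphisms (abc-iut-f-067's model-independence test, STATUS
08:33:42Z) plus the cusps of the objects (decomposition groups — the one non-`Prop` datum every
`Π`-chain statement needs for its • steps; (i′)/(ii′) do not read it):

* `IsFinEt f` — "finite étale" among the datum's dominant `k`-morphisms, with the law that such an
  `f` induces an injective outer homomorphism with open image; `IsOpenImmersion ι` — "open
  immersion", with the law that `[π₁(ι)]` is surjective; `IsOncePuncturedElliptic D` (§0 p. 6, type
  `(1,1)`); `IsEllipticallyAdmissible X` (Def 3.1, primitive as before — its printed definition is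
  `AbsTopII.IsEllipticallyAdmissibleWith` over abc-iut-L4-t6's `IsogenyModel`);
* (a) the CORE inside the datum: `KIsogenous`, **`IsCoreOf b C X`** — `C` terminal among the datum
  objects `k`-isogenous to `X` through finite étale morphisms (verbatim the shape of
  `IsogenyModel.IsCoreOf`, [Mzk6] Rmk 2.1.1 via Def 3.1 (a)); the statements quantify over ALL datum
  cores `(C, f : X → C)` of `X` and over REPRESENTATIVES `φ` of the outer class `[π₁(f)]` (`toCore` is
  no longer a free homomorphism);
* (b) **`doubleCoverSubgroups b C`** — the `Π_D ⊆ Π_C` that are images of representatives of `[π₁(g)]`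
  for finite étale `g : D → C` in the datum of index `2` with `D` a once-punctured elliptic curve
  ("double coverings `D → C` that exhibit `C` as semi-elliptic", Rmk 3.1.1);
* (c) **`Setting`** — the running data of (iii) as a STRUCTURE of group-theoretic data (`G′`, `N`,
  `Π_V`) and datum data (`D`, `g : D → C`), no free type; the OUTPUT "`Π_{U_X} ↠ Π`" is compared with
  `[π₁(ι)]` for an open immersion `ι : U → X` of the datum.
* `Cor_3_3_i′`, `Cor_3_3_ii′`, `Cor_3_3_iii′` — the three rows, conclusions as in the frozen file
  ((3_Π) pro-`Σ` chain vocabulary `IsProSigmaChain` / `IsEtLocTerminalFor` /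
  `HasProSigmaTerminalChainOfType` KEPT, abc-iut-L4-t6 08:23:45Z (α); the chain-CONTENT refinement of
  (iii)(a), abc-iut-L4-t6's `EllipticCuspidalization.RealizesChain` (row «COR33-CHAIN-CONTENT»), is
  conjoined in the sequel `Cor_3_3_iii″` once that definition lands).

WHY THE VACUITY WITNESSES OF p431138 NO LONGER APPLY: (i) the core is not choosable — it is a datum
object `C` TERMINAL among the `k`-isogenous objects, with `toCore` a representative of `[π₁(f)]`; the
p431138 witness "`C := X`, `toCore := 𝟙`" is available only when `X` IS its own core in the datum
(then "`Π` co-Hopfian over `G` up to `Δ`-inner" is the printed content: a finite étale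
`k`-self-cover of the core is an automorphism); (ii) `doubleCovers := univ` is gone — the left-hand
side is computed from the datum's degree-`2` finite étale morphisms onto the core; (iii)
`Setting := ∅` is gone — settings are records of group-theoretic data any consumer can write down,
`Π_D` ranging over `doubleCoverSubgroups`, and the output is compared with `[π₁]` of a datum open
immersion.  What REMAINS model-relative (honest scope): the flags are primitive; the identification
"`U_X` = `X` minus the `N`-torsion points of `D`" is not expressible over the datum (no points), so
(iii′) asserts the constructed `Π_{U_X} ↠ Π` is `[π₁(ι)]` for SOME open immersion `ι : U → X` of
the datum with the printed cusps clause (c) -- TODO(general form); (i)/(ii) in the instance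
`G′ = G` as in the frozen file -- TODO(general form): `G′ ⊊ G`.
HONEST FRAMING: predicates on a MODEL INTERFACE the tree does not instantiate (étale `π₁`,
FOUNDATIONS row 12); "content-light as typed" was about OUR typing, not about the published
corollary; typed ≠ proved; nothing here bears on [IUTchIII] Cor 3.12.
-/

noncomputable section

open CategoryTheory Topology
open scoped Pointwise

universe u

namespace Literature.AnabelianGeometry.AbsoluteAnabelian.AbsTopII

open Literature.AlgebraicGeometry.Frobenioids (IsSlimGroup)
open Literature.AnabelianGeometry.Anabelioids (IsSigmaInteger)
open FundamentalExtension
open AbsTopI (ConstructionDataClass)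
open AugmentedProfiniteGrp

variable {𝒟 : ConstructionDataClass.{u}}

/-! ### The model interface: `Prop`-valued flags on the datum (and the cusps) -/

/-- MODEL INTERFACE (shape (M)) for Cor 3.3 over a class `𝒟`, v2 (finding F-f067-1): ONLY
`Prop`-valued primitive flags with a printed meaning on the objects / morphisms of the datum
`(𝒟.datum b)` — "finite étale" and "open immersion" among its dominant `k_b`-morphisms (with their
group-theoretic laws), "once-punctured elliptic curve" (§0 p. 6) and "`Π`-elliptically admissible"
(Def 3.1) on its objects — plus the cusps of the objects with their decomposition groups (needed by
the • steps of `Π`-chains and by (iii)(c)).  No core, no double covers, no settings as data: those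
are DEFINED below from the datum. [cite: MochizukiAbsTopII2013, Cor 3.3 pp.67-68] -/
structure EllipticDatumModel (𝒟 : ConstructionDataClass.{u}) : Type (u + 1) where
  /-- the cusps of the object `X`, with their decomposition groups in `Π_X` -/
  cusps : ∀ (b : 𝒟.Base) (X : (𝒟.datum b).Obj), CuspidalData ((𝒟.datum b).ext X)
  /-- "finite étale" (among the dominant `k_b`-morphisms of the datum) -/
  IsFinEt : ∀ {b : 𝒟.Base} {X Y : (𝒟.datum b).Obj}, (𝒟.datum b).Hom X Y → Prop
  /-- LAW: a finite étale `k`-morphism `f : X → Y` induces `[π₁(f)] : Π_X → Π_Y` injective with open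
  image (every representative) -/
  isFinEt_injective : ∀ {b : 𝒟.Base} {X Y : (𝒟.datum b).Obj} (f : (𝒟.datum b).Hom X Y),
    IsFinEt f → ∀ φ : HomOver ((𝒟.datum b).grp X) ((𝒟.datum b).grp Y),
      OuterHom.mk φ = (𝒟.datum b).outerHom f → Function.Injective φ.toHom ∧ φ.IsOpenHom
  /-- "open immersion" (among the dominant `k_b`-morphisms of the datum) -/
  IsOpenImmersion : ∀ {b : 𝒟.Base} {U X : (𝒟.datum b).Obj}, (𝒟.datum b).Hom U X → Prop
  /-- LAW: an open immersion `ι : U → X` induces a SURJECTION `[π₁(ι)] : Π_U ↠ Π_X` -/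
  isOpenImmersion_surjective : ∀ {b : 𝒟.Base} {U X : (𝒟.datum b).Obj} (ι : (𝒟.datum b).Hom U X),
    IsOpenImmersion ι → ∀ ψ : HomOver ((𝒟.datum b).grp U) ((𝒟.datum b).grp X),
      OuterHom.mk ψ = (𝒟.datum b).outerHom ι → Function.Surjective ψ.toHom
  /-- "once-punctured elliptic curve": a hyperbolic CURVE of type `(1, 1)` (§0 p. 6) -/
  IsOncePuncturedElliptic : ∀ b : 𝒟.Base, (𝒟.datum b).Obj → Prop
  /-- Def 3.1: "`X` is `Π`-elliptically admissible" for the datum's quotient `π₁(X) ↠ Π_X` -/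
  IsEllipticallyAdmissible : ∀ b : 𝒟.Base, (𝒟.datum b).Obj → Prop

namespace EllipticDatumModel

variable (M : EllipticDatumModel 𝒟)

/-! ### (a) The `k`-core INSIDE the datum -/

/-- `k`-isogenous INSIDE the datum: `X₁`, `X₂` over `k_b` are dominated by a common object through
finite étale `k_b`-morphisms (the objects of `Loc_k(X)`, [Mzk6] §2 via Def 3.1 (a); §0 p. 6
"isogenous"). [cite: MochizukiAbsTopII2013, Def 3.1 (a) p.65] -/
def KIsogenous (b : 𝒟.Base) (X₁ X₂ : (𝒟.datum b).Obj) : Prop :=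
  ∃ (Y : (𝒟.datum b).Obj) (f₁ : (𝒟.datum b).Hom Y X₁) (f₂ : (𝒟.datum b).Hom Y X₂),
    M.IsFinEt f₁ ∧ M.IsFinEt f₂

/-- **"`C` is a `k`-core of `X`" INSIDE the datum** (Def 3.1 (a): "`X` admits a `k`-core [in the
sense of [Mzk6], Remark 2.1.1] `X → C`"): there is a finite étale `k`-morphism `X → C` in the datum
and `C` is TERMINAL among the datum objects `k`-isogenous to `X` — each admits exactly one finite
étale `k`-morphism to `C` (verbatim the shape of abc-iut-L4-t6's `IsogenyModel.IsCoreOf`).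
[cite: MochizukiAbsTopII2013, Def 3.1 (a) p.65] -/
def IsCoreOf (b : 𝒟.Base) (C X : (𝒟.datum b).Obj) : Prop :=
  (∃ f : (𝒟.datum b).Hom X C, M.IsFinEt f) ∧
    ∀ Y : (𝒟.datum b).Obj, M.KIsogenous b Y X →
      (∃ g : (𝒟.datum b).Hom Y C, M.IsFinEt g) ∧
        ∀ g g' : (𝒟.datum b).Hom Y C, M.IsFinEt g → M.IsFinEt g' → g = g'

/-! ### (b) The semi-elliptic double coverings INSIDE the datum -/

/-- **"the open subgroups `Π_D ⊆ Π_C` that arise from finite étale double coverings `D → C` that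
exhibit `C` as semi-elliptic [cf. Remark 3.1.1]"** (Cor 3.3 (ii) p. 68), INSIDE the datum: the images
in `Π_C` of the representatives of `[π₁(g)]` for the finite étale `k`-morphisms `g : D → C` of the
datum whose image has index `2` ("double covering") and whose source `D` is a once-punctured
elliptic curve (§0 p. 6 "semi-elliptic": "a finite étale double covering `Y → X`, where `Y` is a
once-punctured elliptic curve"). [cite: MochizukiAbsTopII2013, Cor 3.3 (ii) p.68] -/
def doubleCoverSubgroups (b : 𝒟.Base) (C : (𝒟.datum b).Obj) :
    Set (Subgroup ((𝒟.datum b).ext C).arith) :=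
  {J | ∃ (D : (𝒟.datum b).Obj) (g : (𝒟.datum b).Hom D C)
      (φ : HomOver ((𝒟.datum b).grp D) ((𝒟.datum b).grp C)),
      M.IsFinEt g ∧ M.IsOncePuncturedElliptic b D ∧ OuterHom.mk φ = (𝒟.datum b).outerHom g ∧
        J = φ.toHom.toMonoidHom.range ∧ J.index = 2}

/-! ### The standing hypotheses -/

/-- The STANDING HYPOTHESES of Cor 3.3 p. 67 on one member (all but the `𝒟`-hypotheses), as in the
frozen file: "`G` a slim profinite group; `1 → Δ → Π → G → 1` an extension of GSAFG-type [⇒ `Δ` slim,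
`Δ ≠ 1`] that admits partial construction data `(k, X, Σ)`, where `k` is of characteristic zero, and
`X` is a `Π`-elliptically admissible hyperbolic orbicurve, such that `([X],[k],Σ) ∈ 𝒟` [...]. Suppose
further that, for some `l ∈ Σ`, the cyclotomic character `G → ℤ_l^×` has open image."
[cite: MochizukiAbsTopII2013, Cor 3.3 p.67] -/
structure IsCor33Member (b : 𝒟.Base) (X : (𝒟.datum b).Obj) : Prop where
  /-- `([X],[k_b],Σ_b) ∈ 𝒟` -/
  mem : 𝒟.Mem b X
  /-- "`X` is a `Π`-elliptically admissible hyperbolic orbicurve" -/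
  ellipticallyAdmissible : M.IsEllipticallyAdmissible b X
  /-- "`G` a slim profinite group" (`G = Gal(k̄_b/k_b)`) -/
  slim : IsSlimGroup ((𝒟.datum b).ext X).gal
  /-- "for some `l ∈ Σ`, the cyclotomic character `G → ℤ_l^×` has open image" -/
  cyclotomic : ∃ (l : ℕ) (_ : Fact l.Prime), l ∈ (𝒟.datum b).primes ∧
    IsOpen (Set.range (AbsTopIII.cyclotomicChar (𝒟.fld b) l))
  /-- GSAFG-type: `Δ` is slim ([AbsTopI] Def 2.1 (iii)) -/
  geom_slim : IsSlimGroup ((𝒟.datum b).ext X).geom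
  /-- `X` a hyperbolic orbicurve: `Δ ≠ 1` -/
  geom_ne_bot : ((𝒟.datum b).ext X).geom ≠ ⊥

/-! ### Corollary 3.3 (i′): the core, group-theoretically -/

/-- A length-`1` `Π`-chain `c` *realizes* the datum core morphism `f : X → C`: its last group is
isomorphic to `Π_C` over `G`, the isomorphism carrying the rigidification `Π ⊇ dom → Π₁` to a
REPRESENTATIVE `φ` of `[π₁(f)] : Π → Π_C` ("the finite étale covering `X_{k'} → C` determines a chain
`X_{k'} ⇝ C` [...] whose image `Π' ⇝ Π_C` in `Chain(Π')`", here `k' = k`).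
[cite: MochizukiAbsTopII2013, Cor 3.3 (i) p.67] -/
def RealizesCore (b : 𝒟.Base) (X C : (𝒟.datum b).Obj) (f : (𝒟.datum b).Hom X C)
    {hP : IsSlimGroup ((𝒟.datum b).ext X).arith} {hΔ : IsSlimGroup ((𝒟.datum b).ext X).geom}
    {hne : ((𝒟.datum b).ext X).geom ≠ ⊥} (c : ((𝒟.datum b).ext X).PiChain (M.cusps b X) hP hΔ hne) :
    Prop :=
  c.typeChain = [ElemOpType.finEtQuot] ∧
    ∃ (φ : HomOver ((𝒟.datum b).grp X) ((𝒟.datum b).grp C))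
      (_ : OuterHom.mk φ = (𝒟.datum b).outerHom f)
      (e : c.last.grp ≃ₜ* ((𝒟.datum b).ext C).arith),
      (∀ y, ((𝒟.datum b).ext C).aug (e y) = c.last.proj y) ∧
        ∀ x : c.last.dom, e (c.last.rig x) = φ.toHom (x : ((𝒟.datum b).ext X).arith)

/-- **Corollary 3.3 (i′)** pp. 67–68 relative to the datum, instance `G' = G`: under the
`𝒟`-hypotheses and the standing hypotheses, for EVERY `k`-core `X → C` of `X` INSIDE THE DATUM
(`IsFinEt f`, `IsCoreOf b C X`), "the finite étale covering `X_{k'} → C` determines a chain [...] whose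
image `Π' ⇝ Π_C` in `Chain(Π')` may be characterized 'group-theoretically', up to isomorphism in
`Chain(Π')`, as the unique chain of length `1` in `Chain(Π')`, with associated type-chain `⋎`, such
that the resulting object of `ÉtLoc(Π')` forms a terminal object of `ÉtLoc(Π')`": some length-`1`
`⋎`-chain [with (3_Π)] realizes `f` and is `ÉtLoc`-terminal among pro-`Σ` chains, and every
`ÉtLoc`-terminal length-`1` `⋎`-chain is isomorphic to it in `Chain(Π)` (vocabulary of the frozen
file).  -- TODO(general form): `G' ⊊ G`. [cite: MochizukiAbsTopII2013, Cor 3.3 (i) p.67] -/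
def Cor_3_3_i' : Prop :=
  𝒟.IsChainFull → 𝒟.RelIsomDGC →
    ∀ (b : 𝒟.Base) (X : (𝒟.datum b).Obj) (h : M.IsCor33Member b X) (C : (𝒟.datum b).Obj)
      (f : (𝒟.datum b).Hom X C), M.IsFinEt f → M.IsCoreOf b C X →
      ∃ c : ((𝒟.datum b).ext X).PiChain (M.cusps b X) (((𝒟.datum b).ext X).arith_slim_of_geom_slim_of_gal_slim h.geom_slim h.slim) h.geom_slim h.geom_ne_bot,
        IsProSigmaChain (𝒟.datum b).primes c ∧ M.RealizesCore b X C f c ∧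
          IsEtLocTerminalFor (𝒟.datum b).primes c ∧
          ∀ c' : ((𝒟.datum b).ext X).PiChain (M.cusps b X) (((𝒟.datum b).ext X).arith_slim_of_geom_slim_of_gal_slim h.geom_slim h.slim) h.geom_slim h.geom_ne_bot,
            IsProSigmaChain (𝒟.datum b).primes c' → c'.typeChain = [ElemOpType.finEtQuot] →
              IsEtLocTerminalFor (𝒟.datum b).primes c' → LastTermsIsomorphic c' c

/-! ### Corollary 3.3 (ii′): the semi-elliptic double coverings, group-theoretically -/

/-- **Corollary 3.3 (ii′)** p. 68 relative to the datum, instance `G' = G`: under the hypotheses,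
for EVERY `k`-core `X → C` of `X` inside the datum, "the collection of open subgroups `Π_D ⊆ Π_C`
that arise from finite étale double coverings `D → C` that exhibit `C` as semi-elliptic [cf. Remark
3.1.1]" — COMPUTED FROM THE DATUM (`doubleCoverSubgroups`) — "may be characterized
'group-theoretically' as the collection of open subgroups `J ⊆ Π_C` of index `2` such that `J ∩ Δ_C`
is torsion-free" (abc-iut-L4-t6's real `semiEllipticDoubleCoverSubgroups`).
-- TODO(general form): `G' ⊊ G`. [cite: MochizukiAbsTopII2013, Cor 3.3 (ii) p.68] -/
def Cor_3_3_ii' : Prop :=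
  𝒟.IsChainFull → 𝒟.RelIsomDGC →
    ∀ (b : 𝒟.Base) (X : (𝒟.datum b).Obj), M.IsCor33Member b X →
      ∀ (C : (𝒟.datum b).Obj) (f : (𝒟.datum b).Hom X C), M.IsFinEt f → M.IsCoreOf b C X →
        M.doubleCoverSubgroups b C = semiEllipticDoubleCoverSubgroups ((𝒟.datum b).ext C)

/-! ### Corollary 3.3 (iii′): the cuspidalization `Π_{U_X} ↠ Π`, group-theoretically -/

/-- **The running data of Cor 3.3 (iii) p. 68 as a STRUCTURE of group-theoretic and datum data**
(no free type), relative to a datum core `f : X → C` of the member `X`: a representative `φ` of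
`[π₁(f)] : Π ↪ Π_C`; "a finite étale double covering `D → C` that exhibits `C` as semi-elliptic" — a
datum morphism `g : D → C`, finite étale, `D` once-punctured elliptic, with the image `Π_D` of a
representative of `[π₁(g)]` of index `2`; "`G' ⊆ G` a normal open subgroup"; "`N` a positive integer
which is a product of primes [perhaps with multiplicities] of `Σ`"; "`V → X` arises from a normal open
subgroup `Π_V ⊆ Π`", "`V` a hyperbolic curve over `k'`" (`Π_V ⊆ Π ×_G G'`), "`V → D` arises from an
open immersion `Π_V ↪ Π_D`". [cite: MochizukiAbsTopII2013, Cor 3.3 (iii) p.68] -/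
structure Setting (b : 𝒟.Base) (X C : (𝒟.datum b).Obj) (f : (𝒟.datum b).Hom X C) :
    Type u where
  /-- a representative of `[π₁(f)] : Π → Π_C` -/
  toCore : HomOver ((𝒟.datum b).grp X) ((𝒟.datum b).grp C)
  /-- it represents `[π₁(f)]` -/
  mk_toCore : OuterHom.mk toCore = (𝒟.datum b).outerHom f
  /-- the once-punctured elliptic curve `D` -/
  D : (𝒟.datum b).Obj
  /-- `D` is a once-punctured elliptic curve -/
  isOncePuncturedElliptic : M.IsOncePuncturedElliptic b D
  /-- the double covering `g : D → C` -/
  cover : (𝒟.datum b).Hom D C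
  /-- `g` is finite étale -/
  isFinEt_cover : M.IsFinEt cover
  /-- a representative of `[π₁(g)]` -/
  coverHom : HomOver ((𝒟.datum b).grp D) ((𝒟.datum b).grp C)
  /-- it represents `[π₁(g)]` -/
  mk_coverHom : OuterHom.mk coverHom = (𝒟.datum b).outerHom cover
  /-- `Π_D := Im [π₁(g)] ⊆ Π_C` has index `2` ("double covering") -/
  index_PiD : coverHom.toHom.toMonoidHom.range.index = 2
  /-- "`G' ⊆ G` a normal open subgroup, corresponding to some finite extension `k'`" … -/
  galOpen : Subgroup ((𝒟.datum b).ext X).gal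
  /-- … normal … -/
  normal_galOpen : galOpen.Normal
  /-- … open -/
  isOpen_galOpen : IsOpen (galOpen : Set ((𝒟.datum b).ext X).gal)
  /-- "`N` a positive integer which is a product of primes [perhaps with multiplicities] of `Σ`" -/
  level : ℕ
  /-- `N` is a `Σ`-integer -/
  level_isSigmaInteger : IsSigmaInteger (𝒟.datum b).primes level
  /-- "`V → X` arises from a normal open subgroup `Π_V ⊆ Π`" … -/
  PiV : Subgroup ((𝒟.datum b).ext X).arith
  /-- … normal … -/
  normal_PiV : PiV.Normal
  /-- … open … -/
  isOpen_PiV : IsOpen (PiV : Set ((𝒟.datum b).ext X).arith)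
  /-- … "`V` a hyperbolic curve over `k'`": `Π_V ⊆ Π ×_G G'` … -/
  PiV_le : PiV ≤ galOpen.comap ((𝒟.datum b).ext X).aug.toMonoidHom
  /-- … "`V → D` arises from an open immersion `Π_V ↪ Π_D`" (through `Π ↪ Π_C`) -/
  map_PiV_le : PiV.map toCore.toHom.toMonoidHom ≤ coverHom.toHom.toMonoidHom.range

namespace Setting

variable {M} {b : 𝒟.Base} {X C : (𝒟.datum b).Obj} {f : (𝒟.datum b).Hom X C}

/-- `Π_D ⊆ Π_C` of the setting: the image of the chosen representative of `[π₁(g)]`.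
[cite: MochizukiAbsTopII2013, Cor 3.3 (iii) p.68] -/
def PiD (s : M.Setting b X C f) : Subgroup ((𝒟.datum b).ext C).arith :=
  s.coverHom.toHom.toMonoidHom.range

end Setting

/-- The output `K : EllipticCuspidalization` *matches* the setting `s` over the datum core
`f : X → C`: same `N` and `Σ`, its core is `Π_C` (an isomorphism of extensions under `Π`, through the
representative `φ` of `[π₁(f)]`, carrying `K.PiD` to `Π_D`), its `Π_V` is the given one — and, on
the SCHEME SIDE READ IN THE DATUM, its output "`Π_{U_X} ↠ Π`" is `[π₁(ι)]` for an open immersion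
`ι : U → X` of the datum (an isomorphism over `Π` with a representative `ψ`), with (c) "the
decomposition groups of the closed points of `X` lying in the complement of `U_X` [are] the images
via `Π_{U_X} ↠ Π` of the cuspidal decomposition groups" = the images under `ψ` of the decomposition
groups of the cusps of `U`.  -- TODO(general form): `U = U_X`, the complement of the `N`-torsion
points of `D` (not expressible over the datum). [cite: MochizukiAbsTopII2013, Cor 3.3 (iii) p.68] -/
def Matches {b : 𝒟.Base} {X C : (𝒟.datum b).Obj} {f : (𝒟.datum b).Hom X C} (s : M.Setting b X C f)
    (K : EllipticCuspidalization ((𝒟.datum b).ext X)) : Prop :=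
  K.N = s.level ∧ K.Sigma = (𝒟.datum b).primes ∧
    (∃ e : K.core ≅ (𝒟.datum b).ext C, K.toCore ≫ e.hom = s.toCore.toExtensionHom ∧
      K.PiD.map e.hom.arith.toMonoidHom = s.PiD) ∧
    K.PiV = s.PiV ∧
    ∃ (U : (𝒟.datum b).Obj) (ι : (𝒟.datum b).Hom U X)
      (ψ : HomOver ((𝒟.datum b).grp U) ((𝒟.datum b).grp X)),
      M.IsOpenImmersion ι ∧ OuterHom.mk ψ = (𝒟.datum b).outerHom ι ∧
        (∃ β : K.cuspUX.arith ≃ₜ* ((𝒟.datum b).ext U).arith, ∀ x, ψ.toHom (β x) = K.proj.arith x) ∧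
        K.toCuspidalization.decompositionImages K.cusps =
          {P | ∃ (x : (M.cusps b U).Cusp) (g : ((𝒟.datum b).ext U).arith),
            P = (MulAut.conj g • (M.cusps b U).Dcusp x).map ψ.toHom.toMonoidHom}

/-- **Corollary 3.3 (iii′)** pp. 68–69 relative to the datum: under the `𝒟`-hypotheses and the
standing hypotheses, for every datum core `f : X → C` of `X` and every `N`, "for any `G' ⊆ G` that is
sufficiently small, where 'sufficiently' depends only on `N`, the natural surjection `Π_{U_X} ↠ Π` —
i.e., 'cuspidalization' of `Π` — may be constructed via 'group-theoretic' operations as follows: (a)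
There exists a [not necessarily unique] `Π`-chain [...] with associated type-chain
`⋏, ⋎, ⋏, •, …, •, ⋏, ⋎` [...] that admits a terminal isomorphism with the trivial `Π`-chain [...];
(b) [...]; (c) [...]": for every SETTING `s` (structure of group-theoretic + datum data) with this `N`
and `G' ⊆ G₀` some `EllipticCuspidalization` of `Π ↠ G` matches `s` (`Matches`: core = `Π_C`, `Π_D`,
`Π_V`, output = `[π₁]` of a datum open immersion, cusps clause (c)) and its type-chain / `Π_V` are
those of a genuine pro-`Σ` `Π`-chain with a terminal isomorphism to the trivial chain
(`HasProSigmaTerminalChainOfType`; the CONTENT of (a), "`Π_U ↠ Π_D` recovered from the chain of •'s",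
is abc-iut-L4-t6's `EllipticCuspidalization.RealizesChain`, conjoined in the sequel).
[cite: MochizukiAbsTopII2013, Cor 3.3 (iii) pp.68-69] -/
def Cor_3_3_iii' : Prop :=
  𝒟.IsChainFull → 𝒟.RelIsomDGC →
    ∀ (b : 𝒟.Base) (X : (𝒟.datum b).Obj) (h : M.IsCor33Member b X) (C : (𝒟.datum b).Obj)
      (f : (𝒟.datum b).Hom X C), M.IsFinEt f → M.IsCoreOf b C X → ∀ N : ℕ,
      ∃ G₀ : Subgroup ((𝒟.datum b).ext X).gal, IsOpen (G₀ : Set ((𝒟.datum b).ext X).gal) ∧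
        ∀ s : M.Setting b X C f, s.level = N → s.galOpen ≤ G₀ →
          ∃ K : EllipticCuspidalization ((𝒟.datum b).ext X), M.Matches s K ∧
            HasProSigmaTerminalChainOfType (𝒟.datum b).primes (M.cusps b X) (((𝒟.datum b).ext X).arith_slim_of_geom_slim_of_gal_slim h.geom_slim h.slim)
              h.geom_slim h.geom_ne_bot K.typeChain K.PiV

end EllipticDatumModel

end Literature.AnabelianGeometry.AbsoluteAnabelian.AbsTopII

end
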